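import Literature.MathematicalPhysics.QuantumFieldTheory.Balaban1983to89.B9SmoothHolderClassPReadings
import Literature.MathematicalPhysics.QuantumFieldTheory.Balaban1983to89.B9PerturbationMajorantAlgebra

/-!
# `Balaban1983to89.B9SmoothHolderClassState` — THE REGULAR STATE CLASS OF THE (3.138) STEP: the print-weighted graded bond class `bHZKPG g w` (the certificate's
# pin (P1′) `bXH`) CARRIED TO LENGTH-DIMENSION 2 by the weight `(Lʲη)⁻¹` on BOTH channels, the [4]-(2.60) rescaling calculus that carries members with it, and its
# two READINGS used by the honest Δ⁽²⁾ letters — the sup channel and the (3.44) member of the sandwich D_UG′D\*_U (LOCATED-U8, regular-state left split)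

T. Bałaban, *Propagators for lattice gauge theories in a background field*, Commun. Math. Phys. **99** (1985) 389–434 [`Balaban1985BackgroundPropagators`,
"B9"]; [4] = T. Bałaban, *Propagators and renormalization transformations for lattice gauge theories. II*, Commun. Math. Phys. **96** (1984) 223–250
[`Balaban1984PropagatorsII`].  statement-level skeleton of published theorems with citation tags; proofs where landed; nothing here is a claim about the
Yang–Mills mass gap.  Sequel of `B9SmoothHolderClassP ∕ …PReadings` (dag-n06-l g24) and `B9PerturbationMajorantAlgebra` (g14).

THE PRINT.  p. 398 (remark after (3.47)): *"the choice of powers Lʲη is conventional also. Using Lemma 2.1 in [4] we may replace the factor (Lʲη)^α by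
(Lʲη)^β(L^{j′}η)^γ with β + γ = α"*; Thm 3.3 p. 399 (Theorem 3.1's (3.42)–(3.47) for G = G₀): (3.42)₁ `|Gλ| ≦ B₀(Lʲη)²e^{−δ₀d}|λ|`, (3.42)₂ `|∇_UGλ| ≦ B₀Lʲη…` — a G₀-output
has length-dimension 2 in the sup channel and, being Lipschitz at size Lʲη, dimension 2 in the Hölder channel: `‖Gλ‖_s ≲ (Lʲη)^{2−s}|λ|`; (3.44) p. 398: *"|(∇_UG′(U)∇\*_Uλ)(x)|
≦ B₀′(ε)e^{−δ₀d(y,y′)}(‖λ‖^{ξ′}_ε + |λ|)"* — the sandwich read OUT of a regular class; p. 422: *"convergence of the series (3.130) … in all norms appearing on the left-hand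
sides of the inequalities (3.42)–(3.47)"* — the state of print's induction carries the Hölder sizes.

THE POINT (dag-n06-l LOCATED-U8 + `DELTA2-LETTERS-MEMO.md` §5).  The honest Δ⁽²⁾ letters T_a₂ = Δ⁽²⁾π, T_b₂ = −RG′D\*_UT_a₂ of rows 20–21 (`B9PerturbationMajorant2Letters.maj_ta2_of_src`,
`B9Thm313WholeDelta2LettersAtPinsPrint.ta2_pins_of_h44 ∕ tb₂H_pins_of_h43_of_src`) act on ANY source class `b₁` carrying two readings at dimension 2: `id : b₁ → 𝔠^{(−2)}` and
`D_UG′D\*_U : b₁ → 𝔠^{(−2)}`.  The state class of the (3.138) step that HAS them is the (P1′) class carried to dimension 2: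
    𝔖₂(U) := weightNorm (bHZKPG (U(Γ)) w) ((Lʲη)⁻¹)   — size near y = (Lʲη)⁻²·sup_{Δ̃(y)}|F| + Σ_s-graded (Lʲη)^{s−2}·pair_s(F),
whose unit member is `|F| ≤ (Lʲη)²`, `‖F‖_s ≤ (Lʲη)^{2−s}` (both channels dimension 2 — balanced, the units discipline of LOCATED-U6).  THIS FILE (no `def`; the class is the
displayed `weightNorm … (rwt (geo9K i) (−1)) …` term):
* §1 the [4]-(2.60) RESCALING CALCULUS over any geometry with the member facts `Facts347`: `hasMaj_congr_tgt ∕ _src` (majorants see only `loc` and `IsLoc`), ★ `hasMaj_rescale` (BOTH sides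
  by `(Lʲη)^γ`, |γ| ≦ 4: constant `L^{|γ|}`, rate loss `αδ` — `B9PerturbationMajorantAlgebra.hasMaj_shift` is its `cNormR`-case), `weightNorm_cNormR_loc` (`(Lʲη)^γ·𝔠^{(s)} = 𝔠^{(s+γ)}`),
  `hasMaj_rescale_src_cNormR ∕ _tgt_cNormR` (one side a state norm, the other any class); `hasMaj_of_src_reading` (a raw-class letter precomposed with a sup reading);
* §2 at the bond carrier of a member `i` (geometry `geo9K i`, transporter table `g`): ★★ `hasMaj_id_state` — THE SUP READING `id : 𝔖₂ → 𝔠^{(−2)}` (blocks `blkBK bI`), constant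
  `(w s)⁻¹·L·e^{δr}·L`, from g24's `hasMaj_id_bHZKPG_cNorm`; ★★ `hasMaj_state_of_exponent` — ANY member displayed OUT OF `bHZKP g s` INTO `cNorm (blkBK bI) 1` (the certificate's
  `h44G : HasMaj (bHZKP …) (cNorm blk 1) (Dv ∘ G′ ∘ Dvstar)` = (3.44) for G′, and `h44m`) READS OUT OF 𝔖₂ INTO `𝔠^{(−2)}`, constant `(w s)⁻¹·K·L`, rate `r − αδ`.
With these two readings `ta2_pins_of_h44 (b₁ := 𝔖₂)` and `tb₂H_pins_of_h43_of_src (b₁ := 𝔖₂)` are the `ta₂ ∕ tb₂H` fields of rows 20–21 at the regular state; the producers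
INTO 𝔖₂ (G₀, G₀D_U, G₀Q\* from (3.42)₁₂, (3.43)) and the step schema over 𝔖₂ are the sequel.
HONEST SCOPE.  Bookkeeping over landed objects; the member facts ([4] (2.60)) and every class member enter as HYPOTHESES; nothing of [B9]∕[4] asserted; no pin, no certificate
edit; COUNT-NEUTRAL; N06 NOT discharged; one finite torus at a time — nothing continuum ∕ OS ∕ mass gap.  Cell `pub-ymgap` (HUMAN RULING D-0062), Track A node N06 [B9], bundle F7
rows 20–21, seat `pub-ymgap-dag-n06-l` (g26), 2026-08-29.  NEW file; nothing landed is modified.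
-/

noncomputable section

namespace Literature.MathematicalPhysics.QuantumFieldTheory.Balaban1983to89.B9SmoothHolderClassState

open B6GlobalChartV1 (PV blkV1)
open B6Ineq2142KLevelV1 (β lvl)
open B6KLevelCensusIndexV1 (KIdx)
open B6Prop22KLevelTorusCensusEta (nKT)
open B9GeoNormsKLevelV1 (geo9K)
open B9Thm34Ext (toB6)
open B9SectDSup (weightNorm weightNorm_loc)
open B11SectG (BlockNorm HasMaj)
open B9Thm312Whole (GeoOK cNorm)
open B9Thm312WholeClasses (cNormR rwt rwt_nonneg cNormR_loc_neg_natCast)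
open B9RWSums343to347Whole (Facts347)
open B9RWSums346Schur (scaleTransfer_len_rpow)
open B9CoReadingCoords (XBK blkBK)
open B9CoReadingCoordsS (sIK)
open B9MultiscaleSmoothPartitionY (NearY)
open B9SmoothHolderClassP (bHZKP bHZKPG hasMaj_from_bHZKPG)
open B9SmoothHolderClassPReadings (hasMaj_id_bHZKPG_cNorm)
open B9PerturbationMajorantAlgebra (rpow_abs_eq_pow hasMaj_weaken)
open Node00 (SiteY FBondY IBondY toKT)

/-! ## §1 The [4]-(2.60) rescaling calculus -/

section Rescale

variable {g : B9.Geometry} [Fintype g.Site] {R₀ : ℝ} {H₀ : Prop}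
variable {F₁ F₂ : Type} [AddCommGroup F₁] [Module ℝ F₁] [AddCommGroup F₂] [Module ℝ F₂]

/-- a majorant sees the target class only through its local sizes. [cite: Balaban1984PropagatorsII, (2.51) p.232 (bookkeeping)] -/
theorem hasMaj_congr_tgt {b₁ : BlockNorm (toB6 g R₀ H₀) F₁} {b₂ b₂' : BlockNorm (toB6 g R₀ H₀) F₂} {T : F₁ →ₗ[ℝ] F₂} {K : g.Site → g.Site → ℝ}
    (hloc : ∀ y f, b₂'.loc y f = b₂.loc y f) (h : HasMaj b₁ b₂ T K) : HasMaj b₁ b₂' T K := by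
  intro y' μ hμ y
  rw [hloc]
  exact h y' μ hμ y

/-- a majorant sees the source class only through its local sizes and its localisation predicate. [cite: Balaban1984PropagatorsII, (2.51) p.232 (bookkeeping)] -/
theorem hasMaj_congr_src {b₁ b₁' : BlockNorm (toB6 g R₀ H₀) F₁} {b₂ : BlockNorm (toB6 g R₀ H₀) F₂} {T : F₁ →ₗ[ℝ] F₂} {K : g.Site → g.Site → ℝ}
    (hloc : ∀ y f, b₁'.loc y f = b₁.loc y f) (hisLoc : ∀ y f, b₁'.IsLoc y f → b₁.IsLoc y f) (h : HasMaj b₁ b₂ T K) : HasMaj b₁' b₂ T K := by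
  intro y' μ hμ y
  rw [hloc]
  exact h y' μ (hisLoc y' μ hμ) y

/-- `(Lʲη)^γ · 𝔠^{(s)} = 𝔠^{(s+γ)}` on local sizes. [cite: Balaban1985BackgroundPropagators, (3.41) p.397 (bookkeeping)] -/
theorem weightNorm_cNormR_loc (hG : GeoOK g) {X : Type} [Fintype X] (blk : X → g.Site) (s γ : ℝ) (y : g.Site) (f : X → ℝ) :
    (weightNorm (cNormR R₀ H₀ blk hG.lenle s) (rwt g γ) (rwt_nonneg hG.lenle γ)).loc y f = (cNormR R₀ H₀ blk hG.lenle (s + γ)).loc y f := by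
  simp only [cNormR, weightNorm_loc, rwt, Real.rpow_add (hG.lenpos y)]
  ring

/-- ★ **THE [4]-(2.60) RESCALING OF A MAJORANT, BOTH SIDES**: `T : b₁ → b₂` with `C·e^{−rd}` is `T : (Lʲη)^γ·b₁ → (Lʲη)^γ·b₂` with `C·L^{|γ|}·e^{−(r−αδ)d}`, |γ| ≦ 4, under the member
facts (`Facts347`: 4·log L ≦ αδRM).  `hasMaj_shift` is the case `b₁, b₂` = state norms. [cite: Balaban1985BackgroundPropagators, p.398 (remark after (3.47)); Balaban1984PropagatorsII, Lemma 2.1 (2.60) p.234] -/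
theorem hasMaj_rescale (hG : GeoOK g) {dF : ℕ} {δ α L₀ : ℝ} (hF : Facts347 g R₀ H₀ dF δ α L₀)
    {b₁ : BlockNorm (toB6 g R₀ H₀) F₁} {b₂ : BlockNorm (toB6 g R₀ H₀) F₂} {T : F₁ →ₗ[ℝ] F₂} {C r : ℝ} (γ : ℝ) (hγ : |γ| ≤ 4) (hC : 0 ≤ C)
    (h : HasMaj b₁ b₂ T (fun a b => C * Real.exp (-(r * g.dist a b)))) :
    HasMaj (weightNorm b₁ (rwt g γ) (rwt_nonneg hG.lenle γ)) (weightNorm b₂ (rwt g γ) (rwt_nonneg hG.lenle γ)) T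
      (fun a b => C * g.L ^ |γ| * Real.exp (-((r - α * δ) * g.dist a b))) := by
  intro y' μ hμ y
  have hb := h y' μ hμ y
  rw [weightNorm_loc, weightNorm_loc]
  simp only [rwt]
  set N := b₂.loc y (T μ) with hN
  set N' := b₁.loc y' μ with hN'
  have hN0 : 0 ≤ N := b₂.loc_nonneg y (T μ)
  have hN'0 : 0 ≤ N' := b₁.loc_nonneg y' μ
  have hγ0 : 0 ≤ g.len y ^ γ := Real.rpow_nonneg (hG.lenle y) γ
  have hst : Real.exp (-(α * δ * g.dist y y')) * g.len y ^ γ ≤ g.L ^ |γ| * g.len y' ^ γ := by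
    have h1 := scaleTransfer_len_rpow hF γ hγ y' y
    rw [hG.symm y' y] at h1
    exact h1
  have hsplit : Real.exp (-(r * g.dist y y')) = Real.exp (-((r - α * δ) * g.dist y y')) * Real.exp (-(α * δ * g.dist y y')) := by
    rw [← Real.exp_add]; congr 1; ring
  have hE : 0 ≤ C * Real.exp (-((r - α * δ) * g.dist y y')) := mul_nonneg hC (Real.exp_nonneg _)
  calc g.len y ^ γ * N ≤ g.len y ^ γ * (C * Real.exp (-(r * g.dist y y')) * N') := mul_le_mul_of_nonneg_left hb hγ0
    _ = C * Real.exp (-((r - α * δ) * g.dist y y')) * (Real.exp (-(α * δ * g.dist y y')) * g.len y ^ γ) * N' := by rw [hsplit]; ring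
    _ ≤ C * Real.exp (-((r - α * δ) * g.dist y y')) * (g.L ^ |γ| * g.len y' ^ γ) * N' :=
        mul_le_mul_of_nonneg_right (mul_le_mul_of_nonneg_left hst hE) hN'0
    _ = C * g.L ^ |γ| * Real.exp (-((r - α * δ) * g.dist y y')) * (g.len y' ^ γ * N') := by ring

/-- rescaling with the SOURCE a state norm: `T : 𝔠_V^{(t)} → b₂` ⟹ `T : 𝔠_V^{(t+γ)} → (Lʲη)^γ·b₂`. [cite: Balaban1985BackgroundPropagators, p.398 (remark after (3.47)); Balaban1984PropagatorsII, (2.60) p.234] -/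
theorem hasMaj_rescale_src_cNormR (hG : GeoOK g) {dF : ℕ} {δ α L₀ : ℝ} (hF : Facts347 g R₀ H₀ dF δ α L₀) {V : Type} [Fintype V] {blkV : V → g.Site}
    {b₂ : BlockNorm (toB6 g R₀ H₀) F₂} {T : (V → ℝ) →ₗ[ℝ] F₂} {C r t : ℝ} (γ : ℝ) (hγ : |γ| ≤ 4) (hC : 0 ≤ C)
    (h : HasMaj (cNormR R₀ H₀ blkV hG.lenle t) b₂ T (fun a b => C * Real.exp (-(r * g.dist a b)))) :
    HasMaj (cNormR R₀ H₀ blkV hG.lenle (t + γ)) (weightNorm b₂ (rwt g γ) (rwt_nonneg hG.lenle γ)) T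
      (fun a b => C * g.L ^ |γ| * Real.exp (-((r - α * δ) * g.dist a b))) :=
  hasMaj_congr_src (fun y f => (weightNorm_cNormR_loc hG blkV t γ y f).symm) (fun _ _ hl => hl) (hasMaj_rescale hG hF γ hγ hC h)

/-- rescaling with the TARGET a state norm: `T : b₁ → 𝔠^{(s)}` ⟹ `T : (Lʲη)^γ·b₁ → 𝔠^{(s+γ)}`. [cite: Balaban1985BackgroundPropagators, p.398 (remark after (3.47)); Balaban1984PropagatorsII, (2.60) p.234] -/
theorem hasMaj_rescale_tgt_cNormR (hG : GeoOK g) {dF : ℕ} {δ α L₀ : ℝ} (hF : Facts347 g R₀ H₀ dF δ α L₀) {X : Type} [Fintype X] {blk : X → g.Site}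
    {b₁ : BlockNorm (toB6 g R₀ H₀) F₁} {T : F₁ →ₗ[ℝ] (X → ℝ)} {C r s : ℝ} (γ : ℝ) (hγ : |γ| ≤ 4) (hC : 0 ≤ C)
    (h : HasMaj b₁ (cNormR R₀ H₀ blk hG.lenle s) T (fun a b => C * Real.exp (-(r * g.dist a b)))) :
    HasMaj (weightNorm b₁ (rwt g γ) (rwt_nonneg hG.lenle γ)) (cNormR R₀ H₀ blk hG.lenle (s + γ)) T
      (fun a b => C * g.L ^ |γ| * Real.exp (-((r - α * δ) * g.dist a b))) :=
  hasMaj_congr_tgt (fun y f => (weightNorm_cNormR_loc hG blk s γ y f).symm) (hasMaj_rescale hG hF γ hγ hC h)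


/-- ★ **PRECOMPOSING WITH THE SUP READING OF A STATE CLASS**: a letter `T : cNorm blk q → b₂` (`t·e^{−δ_T d}`, e.g. today's `hta`, `tbH` of rows 20–21 on the raw class) and
a sup reading `id : 𝔖 → 𝔠^{(−q)}` of a state class (`C_s·e^{−r d}`) give `T : 𝔖 → b₂` with `t·C_s·c·e^{−ρd}` (ρ ≦ r, ρ + σ ≦ δ_T) — [4] (2.54) through the sharp class (cost 1).
[cite: Balaban1984PropagatorsII, (2.52)–(2.56) pp.232–233 + Lemma 2.1 (2.61) p.234; Balaban1985BackgroundPropagators, (3.131) p.422] -/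
theorem hasMaj_of_src_reading (hG : GeoOK g) {σ c : ℝ} (hrow : B11SectG.RowSum (toB6 g R₀ H₀) σ c) {X : Type} [Fintype X] {blk : X → g.Site} {q : ℕ}
    {𝔖 : BlockNorm (toB6 g R₀ H₀) (X → ℝ)} {b₂ : BlockNorm (toB6 g R₀ H₀) F₂} {T : (X → ℝ) →ₗ[ℝ] F₂} {t δT Cs r ρ : ℝ}
    (ht : 0 ≤ t) (hCs : 0 ≤ Cs) (hρ : 0 ≤ ρ) (hρr : ρ ≤ r) (hρT : ρ + σ ≤ δT)
    (hT : HasMaj (cNorm R₀ H₀ blk hG.lenle q) b₂ T (fun a b => t * Real.exp (-(δT * g.dist a b))))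
    (hsrc : HasMaj 𝔖 (cNormR R₀ H₀ blk hG.lenle (-(q : ℝ))) LinearMap.id (fun a b => Cs * Real.exp (-(r * g.dist a b)))) :
    HasMaj 𝔖 b₂ T (fun a b => t * Cs * c * Real.exp (-(ρ * g.dist a b))) := by
  have hT' : HasMaj (cNormR R₀ H₀ blk hG.lenle (-(q : ℝ))) b₂ T (fun a b => t * Real.exp (-(δT * g.dist a b))) := by
    intro y' μ hμ y
    have h := hT y' μ hμ y
    rwa [← cNormR_loc_neg_natCast hG] at h
  have h := B9PerturbationMajorantAlgebra.hasMaj_comp_cNormR hG hrow ht hCs hρ hρr hρT hT' hsrc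
  exact h.congr fun μ => rfl

end Rescale

/-! ## §2 The two readings of the state class `𝔖₂ = (Lʲη)⁻¹·bHZKPG g w` used by the honest Δ⁽²⁾ letters -/

section Readings

variable {d ℓ : ℕ} {hd : 1 ≤ d + 1} {hL : Odd (ℓ + 1) ∧ 1 < ℓ + 1} {b₀ b₁ : ℝ}
variable {𝔸 : Type} [NormedRing 𝔸] [NormedAlgebra ℂ 𝔸]
variable {κ : Type} [Fintype κ]
variable (i : KIdx d ℓ hd hL b₀ b₁) [Fintype (geo9K i).Site] (b : Module.Basis κ ℝ 𝔸) (g : FBondY i → FBondY i → 𝔸ˣ) {R : ℝ} {H : Prop}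
variable (w : ℝ → ℝ) (hw0 : ∀ s, 0 ≤ w s) (hw1 : ∀ s, w s ≤ 1)
variable {F₂ : Type} [AddCommGroup F₂] [Module ℝ F₂]

/-- ★★ **THE SUP READING OF THE STATE CLASS**: `id : 𝔖₂ → 𝔠^{(−2)}` on the blocks `blkBK bI` — a unit member of `(Lʲη)⁻¹·bHZKPG` has `|F| ≤ (Lʲη)²·(w s)⁻¹·L·e^{δr}·L` blockwise — from the
class axiom `hX` of the (P1′) pin (`hasMaj_id_bHZKPG_cNorm`, any `0 < s < 1` with `0 < w s`) by one rescaling (γ = −1).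
[cite: Balaban1985BackgroundPropagators, (3.41)–(3.42) p.397 + p.398 (remark after (3.47)); Balaban1984PropagatorsII, (2.51)–(2.54) p.232, (2.60) p.234] -/
theorem hasMaj_id_state (hG : GeoOK (geo9K i)) {dF : ℕ} {δF α L₀ : ℝ} (hF : Facts347 (geo9K i) R H dF δF α L₀)
    {s : ℝ} (hs0 : 0 < s) (hs1 : s < 1) (hws : 0 < w s) {bI : FBondY i → IBondY i}
    (hlev : ∀ f : FBondY i, lvl i.hN i.D i.hk (bI f) = (blkV1 i.hN i.D f).1.1) (hbI0 : ∀ f : FBondY i, bI f = bI ⟨f.src, 0⟩)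
    {r δ : ℝ} (hδ : 0 ≤ δ) (hN : ∀ (y : IBondY i) (z : SiteY i), NearY i y z → (geo9K i).dist y (sIK i bI z) ≤ r)
    (hcf : |i.cf| = (nKT (toKT i) : ℝ)) :
    HasMaj (weightNorm (bHZKPG (κ := κ) i b g (R := R) (H := H) w hw0 hw1) (rwt (geo9K i) (-1)) (rwt_nonneg hG.lenle (-1)))
      (cNormR R H (blkBK i bI) hG.lenle (-2)) LinearMap.id
      (fun y y' => (w s)⁻¹ * ((((ℓ + 1 : ℕ) : ℝ)) * Real.exp (δ * r)) * (geo9K i).L * Real.exp (-((δ - α * δF) * (geo9K i).dist y y'))) := by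
  have h0 := hasMaj_id_bHZKPG_cNorm i b g (R := R) (H := H) w hw0 hw1 hs0 hs1 hws hG.lenle hlev hbI0 hδ hN hcf
  have h1 : HasMaj (bHZKPG (κ := κ) i b g (R := R) (H := H) w hw0 hw1) (cNormR R H (blkBK i bI) hG.lenle (-1)) LinearMap.id
      (fun y y' => (w s)⁻¹ * ((((ℓ + 1 : ℕ) : ℝ)) * Real.exp (δ * r)) * Real.exp (-(δ * (geo9K i).dist y y'))) := by
    intro y' μ hμ y
    have hb := h0 y' μ hμ y
    rw [← cNormR_loc_neg_natCast hG] at hb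
    rw [Nat.cast_one] at hb
    refine hb.trans (le_of_eq ?_)
    ring
  have hK : 0 ≤ (w s)⁻¹ * ((((ℓ + 1 : ℕ) : ℝ)) * Real.exp (δ * r)) := by
    have := hws.le; positivity
  have h2 := hasMaj_rescale_tgt_cNormR hG hF (-1 : ℝ) (by norm_num) hK h1
  rw [rpow_abs_eq_pow (geo9K i).L (-1) 1 (by norm_num), pow_one, show (-1 : ℝ) + -1 = -2 by norm_num] at h2
  exact h2

/-- ★★ **A MEMBER OUT OF `bHZKP g s` READS OUT OF THE STATE CLASS**: any `HasMaj (bHZKP g s) (cNorm blk 1) T (K·e^{−rd})` (the certificate's (3.44) displays `h44G` for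
`T = Dv ∘ G′ ∘ Dvstar` and `h44m` for the G₀-sandwiches, at exponent `s`, dimension 1) is `HasMaj 𝔖₂ (cNormR blk (−2)) T ((w s)⁻¹·K·L·e^{−(r−αδ)d})` — the graded projection
`hasMaj_from_bHZKPG` and one rescaling (γ = −1). [cite: Balaban1985BackgroundPropagators, (3.44) p.398 + p.398 (remark after (3.47)); Balaban1984PropagatorsII, (2.51) p.232, (2.60) p.234] -/
theorem hasMaj_state_of_exponent (hG : GeoOK (geo9K i)) {dF : ℕ} {δF α L₀ : ℝ} (hF : Facts347 (geo9K i) R H dF δF α L₀)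
    {s : ℝ} (hs0 : 0 < s) (hs1 : s < 1) (hws : 0 < w s) {X : Type} [Fintype X] {blk : X → IBondY i}
    {T : (XBK κ i → ℝ) →ₗ[ℝ] (X → ℝ)} {K r : ℝ} (hK : 0 ≤ K)
    (h : HasMaj (bHZKP (κ := κ) i b g (R := R) (H := H) (s := s) hs0.le hs1.le) (cNorm R H blk hG.lenle 1) T
      (fun y y' => K * Real.exp (-(r * (geo9K i).dist y y')))) :
    HasMaj (weightNorm (bHZKPG (κ := κ) i b g (R := R) (H := H) w hw0 hw1) (rwt (geo9K i) (-1)) (rwt_nonneg hG.lenle (-1)))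
      (cNormR R H blk hG.lenle (-2)) T
      (fun y y' => (w s)⁻¹ * K * (geo9K i).L * Real.exp (-((r - α * δF) * (geo9K i).dist y y'))) := by
  have h0 := hasMaj_from_bHZKPG i b g w hw0 hw1 hs0 hs1 hws (fun _ _ => by positivity) h
  have h1 : HasMaj (bHZKPG (κ := κ) i b g (R := R) (H := H) w hw0 hw1) (cNormR R H blk hG.lenle (-1)) T
      (fun y y' => (w s)⁻¹ * K * Real.exp (-(r * (geo9K i).dist y y'))) := by
    intro y' μ hμ y
    have hb := h0 y' μ hμ y
    rw [← cNormR_loc_neg_natCast hG] at hb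
    rw [Nat.cast_one] at hb
    refine hb.trans (le_of_eq ?_)
    ring
  have hK' : 0 ≤ (w s)⁻¹ * K := mul_nonneg (inv_nonneg.2 hws.le) hK
  have h2 := hasMaj_rescale_tgt_cNormR hG hF (-1 : ℝ) (by norm_num) hK' h1
  rw [rpow_abs_eq_pow (geo9K i).L (-1) 1 (by norm_num), pow_one, show (-1 : ℝ) + -1 = -2 by norm_num] at h2
  exact h2

end Readings

end Literature.MathematicalPhysics.QuantumFieldTheory.Balaban1983to89.B9SmoothHolderClassState

end
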